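import Summits.BirchSwinnertonDyer.Rank1Residual.GaloisImage.KolyvaginCongruenceRatBot
import Summits.BirchSwinnertonDyer.Rank1Residual.GaloisImage.KolyvaginEulerFactorOperatorRat
import Summits.BirchSwinnertonDyer.Rank1Residual.GaloisImage.KolyvaginDerivativeNormCompatible
import HarnessLib

/-!
# THEOREM C of row T-DER for `T_p E / ℚ`: the finite–singular relation of Kolyvagin's derivative
# classes of an Euler system over the cyclotomic levels, cocycle form (cell `b2b-bsdres`, n1011
# p11 GEN 9, skel/T-DER.md STATUS v8; referee-1 GEN 35 ACK-1 (vii): the UNCONDITIONAL twin)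

HONEST FRAMING (cell `b2b-bsdres`, run/shared/lean/b2b/bsd-rank1-residual/, verbatim in every
file): the goal of the cell is to DELETE the COMBINATION-SHAPED residual classes of the
Birch–Swinnerton-Dyer formula for ALL analytic-rank `≤ 1` elliptic curves over `ℚ` — "full BSD
formula for every rank `≤ 1` curve in class `C`" assembled STRICTLY from published theorems — so
that the rank-`≤ 1` remainder becomes exactly the CONSTRUCTION-SHAPED classes, which are TYPED
(missing-input `Prop`s), NOT attempted. This is not "finishing BSD". Team n1011: research route on
the CONSTRUCTION-SHAPED class X4 / §I N11 (route-1 PORT, (P-DER)); TOOL theorem: NO Euler system is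
asserted to exist (it is the hypothesis `hc`), no definition, no named fact, no `sorry`.

## What ([Rubin00] Thm. 4.5.4 = [PerrinRiou98] Prop. 3.2.6 (ii) / Prop. 2.2.5 (ii), for `T_p E / ℚ`)

Data: `E/ℚ` (globally minimal `W`), an odd prime `p`, an Euler system `c` of `T = T_p E` over
`cyclotomicLevelsRat p S` (`hc`, a HYPOTHESIS), `red : T ⟶ T′` with `p^k T′ = 0` (`k ≥ 1`), a
level `r`, a Kolyvagin prime `q ∉ r` of level `k`, generators `σ_ℓ` (`ℓ ∈ rq`) of
`Gal(ℚ(μ_ℓ)/ℚ)` in the T-DER-INST shapes (`hσ`, `hcov`, `hinj`) WITH `σ_q` IN THE INERTIA GROUP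
of a prime `𝔔 ∣ q` (`hσI`), an arithmetic Frobenius `φ` at `𝔔` fixing `μ_q` (`hφ`, `hφq`),
`(T′)^{Gal(ℚ̄/ℚ(μ_{rq}))} = 0` (`h0`), `σ_q` trivial on `T′` (`hX'σ`), `P_q(φ⁻¹) T′ = 0` (`hPX`),
classes `κ′, κ ∈ H¹(ℚ, T′)` with `res κ′ = D_{rq}(red_* c_{rq})`, `res κ = D_r(red_* c_r)`
(`hκ'`, `hκ`), ANY representatives `Φ ∈ κ′`, `Φ_r ∈ κ`, ANY `Q` with `(X − 1)Q = P_q − P_q(1)`,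
`P_q = P(φ⁻¹ | T_pE*; X)`.  THEN **`Φ(σ_q) = Q(φ⁻¹) · Φ_r(φ)`** — the cocycle form of
`loc^s_q κ_{rq} = φ^{fs}_q(loc_q κ_r)` ([MR04]; tree `IsFiniteSingularComparisonWith`).
Assembly: G2 `Derivative.apply_eq_aeval_apply_of_congruence` with `htrans` from `cores_cons`
(G1), the Kolyvagin congruence DERIVED from `cores_p` (`KolyvaginCongruence*`), inertia vanishing
(E1), `Z_φ` (K4/E3a), injectivity of `ρ(φ)^f − 1` (CK-2), the on-the-nose extensions (C1) and
their identification with `κ′`, `κ` (F4 uniqueness), representative independence (E3a).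
0 defs, 0 facts.  References: K. Rubin, *Euler Systems* (2000), Thm. 4.5.4, §4.7–4.8;
B. Perrin-Riou, Ann. Inst. Fourier 48 (1998), Prop. 2.2.5 (ii), Prop. 3.2.6; B. Mazur, K. Rubin,
*Kolyvagin systems* (2004), App. A; C.-H. Kim, arXiv:2203.12159, §2.1.2.
-/

noncomputable section

open CategoryTheory Function Finset Polynomial Field IsDedekindDomain
open scoped NumberField Pointwise
open Literature.NumberTheory.GaloisRepresentations Literature.NumberTheory.EllipticCurves
open Literature.NumberTheory.EllipticCurves (subgroupInclusion subgroupInclusion_apply_coe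
  subgroupConj subgroupConj_apply_coe)
open Summit.BirchSwinnertonDyer.Rank1Residual.GaloisImage.CyclotomicLevel
open Rat.HeightOneSpectrum

universe u

namespace Summit.BirchSwinnertonDyer.Rank1Residual.GaloisImage.Derivative.Rat

variable (W : WeierstrassCurve ℚ) [W.IsElliptic] [W.IsGloballyMinimal] {p : ℕ} [Fact p.Prime]
variable [Module.Free ℤ_[p] (W.tateModule p)] [Module.Finite ℤ_[p] (W.tateModule p)]
  [ContinuousSMul ℤ_[p] (W.tateModule p)]
variable (S : Set (HeightOneSpectrum (𝓞 ℚ)))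

/-- Local notation: `T∞ = T_p E` as a continuous `G_ℚ`-representation. -/
local notation3 "T∞" => WeierstrassCurve.tateGaloisRep W p (W.continuous_galoisRepTate_holds p)

/-- Local notation: `𝓛` = the cyclotomic Euler-system levels `ℚ(μ_{p^{n+1}}, μ_r)`, `r ∩ S = ∅`. -/
local notation3 "𝓛" => cyclotomicLevelsRat p S

/-- Local notation: `𝐃⟦X, U, τ⟧ ℓ = ∑_{j < ℓ−1} j·(τ_ℓ)_*^j`, Kolyvagin's derivative operator of the
place `ℓ` on `H¹(U, X)` for the generator `τ_ℓ`. -/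
local notation3 (prettyPrint := false) "𝐃⟦" X ", " U ", " τ "⟧" =>
  fun ℓ : HeightOneSpectrum (𝓞 ℚ) =>
  ∑ j ∈ Finset.range (((primesEquiv ℓ : Nat.Primes) : ℕ) - 1),
    (j : Module.End ℤ_[p] (continuousCohomology 1 (subgroupRep X U))) *
      (conjMap X U ((τ : HeightOneSpectrum (𝓞 ℚ) → absoluteGaloisGroup ℚ) ℓ) 1).hom.toLinearMap ^ j

/-- Local notation: `𝐫⟦f, T′, U⟧ = f_* : H¹(U, T_pE) → H¹(U, T′)`. -/
local notation3 (prettyPrint := false) "𝐫⟦" f ", " Tg ", " U "⟧" =>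
  ContinuousCohomology.map (ContinuousMonoidHom.id _)
    (X := subgroupRep (ContinuousRep.toTopRep T∞) U)
    (Y := subgroupRep (ContinuousRep.toTopRep Tg) U)
    ((TopRep.resFunctor (Subgroup.subtype U)).map f) 1

/-- Local notation: `𝐏⟦φ⟧ = P(φ⁻¹ | T_pE^*; X) = det(1 − φ⁻¹X | T_pE ⊗ χ_cyc)`, Rubin's Euler
factor. -/
local notation3 "𝐏⟦" φ "⟧" =>
  rubinEulerFactor (WeierstrassCurve.galoisRepTate W p) (cyclotomicCharacterToUnits ℚ p ℤ_[p]) φ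

/-- Local notation: `𝐙⟦u, q⟧ ψ = u⁻¹ (a_q ρ(ψ⁻¹) − (q+1) ρ(ψ⁻¹)²)` — the operator with
`P_q(ρ(ψ⁻¹)) = (q − 1) 𝐙⟦u, q⟧ ψ` on `T_pE` when `u = q` and `ψ` is a Frobenius at `q` (K4/E3a). -/
local notation3 (prettyPrint := false) "𝐙⟦" u ", " q "⟧" => fun ψ : absoluteGaloisGroup ℚ =>
  (↑u⁻¹ : ℤ_[p]) • ((WeierstrassCurve.frobeniusTrace W (primesEquiv q) : ℤ_[p]) •
    WeierstrassCurve.galoisRepTate W p ψ⁻¹ -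
      ((((primesEquiv q : Nat.Primes) : ℕ) : ℤ_[p]) + 1) •
        WeierstrassCurve.galoisRepTate W p ψ⁻¹ ^ 2)

/-- **THEOREM C for `T_p E` over `ℚ` — the finite–singular relation of Kolyvagin's derivative
classes, cocycle form** ([Rubin00] Thm. 4.5.4; [PerrinRiou98] Prop. 3.2.6 (ii)): see the module
docstring for the data.  For every representative `Φ` of `κ′` (`res κ′ = D_{rq} red_* c_{rq}`) and
`Φ_r` of `κ` (`res κ = D_r red_* c_r`): `Φ(σ_q) = Q(φ⁻¹) Φ_r(φ)`.  Unconditional in the Euler system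
`c` (hypothesis `hc`): the Kolyvagin congruence is DERIVED (`KolyvaginCongruence*`), not assumed.
[cite: Rubin2000, Thm. 4.5.4] [cite: PerrinRiou1998AIF, Prop. 3.2.6 and Prop. 2.2.5 (ii)] -/
theorem apply_sigma_eq_aeval_apply_of_eulerSystem (hp2 : p ≠ 2)
    {c : ∀ (i : ℕ) (r : (𝓛).Ideals), H1 T∞ ((𝓛).level i r.1)}
    (hc : IsEulerSystem 𝓛 T∞ p c)
    {M' : Type} [AddCommGroup M'] [Module ℤ_[p] M'] [TopologicalSpace M'] [IsTopologicalAddGroup M']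
    [ContinuousSMul ℤ_[p] M'] {T' : GaloisRep ℚ ℤ_[p] M'} (red : T∞.toTopRep ⟶ T'.toTopRep)
    {k : ℕ} (hk : 0 < k) (hM : ∀ m : M', ((p : ℤ_[p]) ^ k) • m = 0)
    (r : (𝓛).Ideals) {q : HeightOneSpectrum (𝓞 ℚ)} (hq : q ∈ (𝓛).primes) (hqr : q ∉ r.1)
    (hKol : Kato.IsKolyvaginPrime W p k ((primesEquiv q : Nat.Primes) : ℕ))
    (σ : HeightOneSpectrum (𝓞 ℚ) → absoluteGaloisGroup ℚ)
    (hσ : ∀ ℓ ∈ (r.cons q hq).1, ∀ ℓ₂ ∈ (r.cons q hq).1, ℓ₂ ≠ ℓ → σ ℓ ∈ (𝓛).tameLevel ℓ₂)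
    (hcov : ∀ ℓ ∈ (r.cons q hq).1, ∀ g : absoluteGaloisGroup ℚ,
      ∃ j < ((primesEquiv ℓ : Nat.Primes) : ℕ) - 1, (σ ℓ ^ j)⁻¹ * g ∈ (𝓛).tameLevel ℓ)
    (hinj : ∀ ℓ ∈ (r.cons q hq).1, ∀ j₁ < ((primesEquiv ℓ : Nat.Primes) : ℕ) - 1,
      ∀ j₂ < ((primesEquiv ℓ : Nat.Primes) : ℕ) - 1,
        (σ ℓ ^ j₁)⁻¹ * σ ℓ ^ j₂ ∈ (𝓛).tameLevel ℓ → j₁ = j₂)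
    {𝔔 : Ideal (absIntegers (𝓞 ℚ) ℚ)} (h𝔔 : 𝔔 ∈ q.primesAbove)
    (hσI : σ q ∈ 𝔔.inertia (absoluteGaloisGroup ℚ))
    {φ : absoluteGaloisGroup ℚ} (hφ : IsArithFrobAt (𝓞 ℚ) φ 𝔔) (hφq : φ ∈ (𝓛).tameLevel q)
    (h0 : ∀ v : T'.toTopRep,
      (∀ u : ((𝓛).level ⊥ (r.cons q hq).1), T'.toTopRep.ρ (u : absoluteGaloisGroup ℚ) v = v) →
        v = 0)
    (hX'σ : ∀ w : M', T'.toTopRep.ρ (σ q) w = w)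
    (hPX : ∀ w : M', aeval ((T'.toTopRep.ρ φ⁻¹ : M' →L[ℤ_[p]] M') : Module.End ℤ_[p] M')
      𝐏⟦φ⟧ w = 0)
    (Q : ℤ_[p][X]) (hQ : (Polynomial.X - C 1) * Q = 𝐏⟦φ⟧ - C (𝐏⟦φ⟧.eval 1))
    (comm') (κ' : continuousCohomology 1 T'.toTopRep)
    (hκ' : resSubgroup T'.toTopRep ((𝓛).level ⊥ (r.cons q hq).1) 1 κ' =
      ((r.cons q hq).1.noncommProd 𝐃⟦T'.toTopRep, ((𝓛).level ⊥ (r.cons q hq).1), σ⟧ comm')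
        (𝐫⟦red, T', ((𝓛).level ⊥ (r.cons q hq).1)⟧ (c ⊥ (r.cons q hq))))
    (comm) (κ : continuousCohomology 1 T'.toTopRep)
    (hκ : resSubgroup T'.toTopRep ((𝓛).level ⊥ r.1) 1 κ =
      (r.1.noncommProd 𝐃⟦T'.toTopRep, ((𝓛).level ⊥ r.1), σ⟧ comm)
        (𝐫⟦red, T', ((𝓛).level ⊥ r.1)⟧ (c ⊥ r)))
    (Φ : contOneCocycles T'.toTopRep) (hΦ : oneCocycleClass _ Φ = κ')
    (Φr : contOneCocycles T'.toTopRep) (hΦr : oneCocycleClass _ Φr = κ) :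
    Φ.1 (σ q) = aeval ((T'.toTopRep.ρ φ⁻¹ : M' →L[ℤ_[p]] M') : Module.End ℤ_[p] M') Q (Φr.1 φ) := by
  classical
  haveI := h𝔔.1
  -- §0 the Kolyvagin prime
  have hq'p : ((primesEquiv q : Nat.Primes) : ℕ).Prime := (primesEquiv q).2
  have hne : ((primesEquiv q : Nat.Primes) : ℕ) ≠ p := hKol.ne
  have h2 : ((primesEquiv q : Nat.Primes) : ℕ) ≠ 2 :=
    Derivative.Rat.ne_two_of_isKolyvaginPrime W p hk hKol
  have hgood : W.HasGoodReductionAt q :=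
    CyclotomicLevel.Rat.hasGoodReductionAt_of_isKolyvaginPrime W hKol
  have hpv : ((p : ℕ) : 𝓞 ℚ) ∉ q.asIdeal :=
    Rat.natCast_not_mem_asIdeal_of_not_dvd fun h =>
      hne ((Nat.prime_dvd_prime_iff_eq hq'p (Fact.out : p.Prime)).mp h)
  have hφP : IsArithFrobAtPlace ℚ q φ := ⟨𝔔, h𝔔, hφ⟩
  have hle : ((𝓛).level ⊥ (r.cons q hq).1) ≤ ((𝓛).level ⊥ r.1) := (𝓛).level_insert_le ⊥ r.1 q
  have hram : ¬ SubgroupIsUnramifiedAt ℚ ((𝓛).level ⊥ (r.cons q hq).1) q :=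
    CyclotomicLevel.Rat.not_subgroupIsUnramifiedAt_cyclotomicLevelsRat_level_insert p S ⊥ h2 r.1
  have hqins : q ∈ (r.cons q hq).1 := Finset.mem_insert_self q r.1
  have hrins : ∀ ℓ ∈ r.1, ℓ ∈ (r.cons q hq).1 := fun ℓ hℓ => Finset.mem_insert_of_mem hℓ
  have hrq : ∀ ℓ ∈ r.1, ℓ ≠ q := fun ℓ hℓ h => hqr (h ▸ hℓ)
  have hsub : ((r.1 : Finset _) : Set (HeightOneSpectrum (𝓞 ℚ))) ⊆ (r.cons q hq).1 :=
    fun ℓ hℓ => Finset.mem_coe.mpr (hrins ℓ (Finset.mem_coe.mp hℓ))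
  -- §1 the exponent datum `f`, `r₀` (CK-1b) and `φ^f ∈ Gal(ℚ̄/ℚ(μ_rq))`
  obtain ⟨-, f, r₀, -, -, hf, hft0, hfp, hr₀, -⟩ :=
    CyclotomicLevel.Rat.exists_frobenius_pow_datum (p := p) (S := S) q r.1 hk hKol.modEq_one
  have hft : ∀ ℓ ∈ r.1,
      ((primesEquiv q : Nat.Primes) : ℕ) ^ f ≡ 1 [MOD ((primesEquiv ℓ : Nat.Primes) : ℕ)] :=
    fun ℓ hℓ => hft0 ℓ hℓ fun h => hqr (h ▸ hℓ)
  have hft' : ∀ ℓ ∈ (r.cons q hq).1, ℓ ≠ q →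
      ((primesEquiv q : Nat.Primes) : ℕ) ^ f ≡ 1 [MOD ((primesEquiv ℓ : Nat.Primes) : ℕ)] := by
    intro ℓ hℓ hℓq
    change ℓ ∈ insert q r.1 at hℓ
    rcases Finset.mem_insert.mp hℓ with rfl | hℓ
    · exact absurd rfl hℓq
    · exact hft ℓ hℓ
  have hφ₁ : φ ^ f ∈ ((𝓛).level ⊥ (r.cons q hq).1) :=
    CyclotomicLevel.Rat.frobenius_pow_mem_level hq hφP hφq _ hft' (by
      rw [Nat.bot_eq_zero, pow_zero]; exact Nat.modEq_one)
  -- §2 the operator `Z_φ = 𝐙⟦u, q⟧ φ` (K4 / E3a), `u = q ∈ ℤ_p^×`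
  obtain ⟨u, hu⟩ : IsUnit ((((primesEquiv q : Nat.Primes) : ℕ) : ℕ) : ℤ_[p]) :=
    PadicCharacter.isUnit_natCast_of_not_dvd fun h =>
      hne ((Nat.prime_dvd_prime_iff_eq (Fact.out : p.Prime) hq'p).mp h).symm
  have hZfc : ∀ ψ, IsArithFrobAtPlace ℚ q ψ → Commute (W.galoisRepTate p ψ) (𝐙⟦u, q⟧ ψ) :=
    fun ψ _ => commute_galoisRepTate_Z W p _ _ _ ψ
  have hZf : ∀ ψ, IsArithFrobAtPlace ℚ q ψ → ∀ t : W.tateModule p,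
      aeval (W.galoisRepTate p ψ⁻¹)
        (rubinEulerFactor (W.galoisRepTate p) (cyclotomicCharacterToUnits ℚ p ℤ_[p]) ψ) t =
      (((((primesEquiv q : Nat.Primes) : ℕ) - 1 : ℕ)) : ℤ_[p]) • 𝐙⟦u, q⟧ ψ t :=
    fun ψ hψ t => aeval_rubinEulerFactor_apply_eq_nsmul_Z W p hne hgood u hu hψ t
  have hZfconj : ∀ (ψ w : absoluteGaloisGroup ℚ) (t : W.tateModule p),
      𝐙⟦u, q⟧ (w⁻¹ * ψ * w) t = W.galoisRepTate p w⁻¹ (𝐙⟦u, q⟧ ψ (W.galoisRepTate p w t)) :=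
    fun ψ w t => Z_conj_apply W p _ _ _ ψ w t
  -- §3 `T`-level representatives `x̃`, `x̃_r` of `D_r c_{rq}` and `D_r c_r`
  have commT' : ((r.1 : Finset _) : Set (HeightOneSpectrum (𝓞 ℚ))).Pairwise fun a b =>
      Commute (𝐃⟦T∞.toTopRep, ((𝓛).level ⊥ (r.cons q hq).1), σ⟧ a)
        (𝐃⟦T∞.toTopRep, ((𝓛).level ⊥ (r.cons q hq).1), σ⟧ b) :=
    (pairwise_commute_deriv (T' := T∞) ⊥ (r.cons q hq).1 σ
      (fun ℓ => ((primesEquiv ℓ : Nat.Primes) : ℕ) - 1)).mono hsub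
  have commT : ((r.1 : Finset _) : Set (HeightOneSpectrum (𝓞 ℚ))).Pairwise fun a b =>
      Commute (𝐃⟦T∞.toTopRep, ((𝓛).level ⊥ r.1), σ⟧ a) (𝐃⟦T∞.toTopRep, ((𝓛).level ⊥ r.1), σ⟧ b) :=
    pairwise_commute_deriv (T' := T∞) ⊥ r.1 σ (fun ℓ => ((primesEquiv ℓ : Nat.Primes) : ℕ) - 1)
  obtain ⟨xt, hxt⟩ := oneCocycleClass_surjective _
    ((r.1.noncommProd 𝐃⟦T∞.toTopRep, ((𝓛).level ⊥ (r.cons q hq).1), σ⟧ commT') (c ⊥ (r.cons q hq)))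
  obtain ⟨xtr, hxtr⟩ := oneCocycleClass_surjective _
    ((r.1.noncommProd 𝐃⟦T∞.toTopRep, ((𝓛).level ⊥ r.1), σ⟧ commT) (c ⊥ r))
  -- §4 THE KOLYVAGIN CONGRUENCE for `(x̃, x̃_r)` at the datum `(𝔔, φ)` (E2-b, from `cores_p`)
  obtain ⟨tc, htc⟩ := Congruence.Rat.cong_noncommProd_deriv_frobenius_pow_bot W S hp2 hc hk r hq hqr
    hKol hf hft hfp hr₀ 𝐙⟦u, q⟧ hZfc hZf hZfconj σ (fun ℓ => ((primesEquiv ℓ : Nat.Primes) : ℕ) - 1)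
    commT' commT (φ ^ f) hφ₁ _ ⟨𝔔, h𝔔, φ, hφ, hφq, rfl, rfl⟩ xt xtr hxt hxtr
  -- §5 the transfer identity `Cor x̃ = P_q(φ⁻¹) x̃_r + ∂(b̃)` (G1, from `cores_cons`)
  have hbot : ∀ g : absoluteGaloisGroup ℚ, g ∈ (𝓛).pLevel ⊥ := fun g => by
    rw [(𝓛).pLevel_bot]; exact Subgroup.mem_top g
  have hσqUr : σ q ∈ ((𝓛).level ⊥ r.1) :=
    mem_level_of_forall 𝓛 (hbot _) fun ℓ hℓ => hσ q hqins ℓ (hrins ℓ hℓ) (hrq ℓ hℓ)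
  have hcovσ : ∀ g ∈ ((𝓛).level ⊥ r.1), ∃ j < ((primesEquiv q : Nat.Primes) : ℕ) - 1,
      (σ q ^ j)⁻¹ * g ∈ ((𝓛).level ⊥ (r.cons q hq).1) := by
    intro g hg
    obtain ⟨j, hj, hjg⟩ := hcov q hqins g
    refine ⟨j, hj, ?_⟩
    have hmem : (σ q ^ j)⁻¹ * g ∈ ((𝓛).level ⊥ r.1) :=
      Subgroup.mul_mem _ (Subgroup.inv_mem _ (Subgroup.pow_mem _ hσqUr j)) hg
    rw [(𝓛).mem_level_iff] at hmem
    change (σ q ^ j)⁻¹ * g ∈ (𝓛).level ⊥ (insert q r.1)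
    refine (𝓛).mem_level_iff.mpr ⟨hmem.1, fun ℓ hℓ => ?_⟩
    rcases Finset.mem_insert.mp hℓ with rfl | hℓ
    · exact hjg
    · exact hmem.2 ℓ hℓ
  have hinjσ : ∀ j₁ < ((primesEquiv q : Nat.Primes) : ℕ) - 1,
      ∀ j₂ < ((primesEquiv q : Nat.Primes) : ℕ) - 1,
        (σ q ^ j₁)⁻¹ * σ q ^ j₂ ∈ ((𝓛).level ⊥ (r.cons q hq).1) → j₁ = j₂ := by
    intro j₁ hj₁ j₂ hj₂ h
    change (σ q ^ j₁)⁻¹ * σ q ^ j₂ ∈ (𝓛).level ⊥ (insert q r.1) at h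
    rw [(𝓛).mem_level_iff] at h
    exact hinj q hqins j₁ hj₁ j₂ hj₂ (h.2 q (Finset.mem_insert_self q _))
  letI : Fintype (((𝓛).level ⊥ r.1) ⧸
      ((𝓛).level ⊥ (r.cons q hq).1).subgroupOf ((𝓛).level ⊥ r.1)) := Fintype.ofFinite _
  have hDa : ∀ ℓ ∈ r.1, ∀ v : continuousCohomology 1 (subgroupRep T∞.toTopRep ((𝓛).level ⊥ r.1)),
      aeval (conjMap T∞.toTopRep ((𝓛).level ⊥ r.1) φ⁻¹ 1).hom.toLinearMap 𝐏⟦φ⟧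
        (𝐃⟦T∞.toTopRep, ((𝓛).level ⊥ r.1), σ⟧ ℓ v) =
      𝐃⟦T∞.toTopRep, ((𝓛).level ⊥ r.1), σ⟧ ℓ
        (aeval (conjMap T∞.toTopRep ((𝓛).level ⊥ r.1) φ⁻¹ 1).hom.toLinearMap 𝐏⟦φ⟧ v) := by
    intro ℓ _ v
    have hcm := (commute_deriv_of_commute ((commute_aeval_of_commute
      (commute_conjMap_hom_level (L := 𝓛) (T' := T∞) ⊥ r.1 (σ ℓ) φ⁻¹) 𝐏⟦φ⟧).symm)
      (((primesEquiv ℓ : Nat.Primes) : ℕ) - 1)).eq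
    have h' := congrArg (fun F : Module.End ℤ_[p] (continuousCohomology 1
      (subgroupRep T∞.toTopRep ((𝓛).level ⊥ r.1))) => F v) hcm
    simp only [Module.End.mul_apply] at h'
    exact h'
  have hCor : coresLe T∞.toTopRep hle ((𝓛).isOpen_level ⊥ _) (oneCocycleClass _ xt) =
      aeval (conjMap T∞.toTopRep ((𝓛).level ⊥ r.1) φ⁻¹ 1).hom.toLinearMap 𝐏⟦φ⟧
        (oneCocycleClass _ xtr) := by
    rw [hxt, hxtr, apply_noncommProd_apply_eq_of_comm
      (coresLe T∞.toTopRep hle ((𝓛).isOpen_level ⊥ _)) r.1 commT' commT (fun ℓ _ v =>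
        apply_deriv_apply_eq_of_comm _ (fun w =>
          Mackey.coresLe_conjMap T∞.toTopRep hle ((𝓛).isOpen_level ⊥ _) (σ ℓ) w) _ v)]
    have hES : coresLe T∞.toTopRep hle ((𝓛).isOpen_level ⊥ _) (c ⊥ (r.cons q hq)) =
        aeval (conjMap T∞.toTopRep ((𝓛).level ⊥ r.1) φ⁻¹ 1).hom.toLinearMap 𝐏⟦φ⟧ (c ⊥ r) :=
      hc.cores_cons ⊥ r q hq hqr hram φ hφP
    rw [hES]
    exact (apply_noncommProd_apply_eq_of_comm
      (aeval (conjMap T∞.toTopRep ((𝓛).level ⊥ r.1) φ⁻¹ 1).hom.toLinearMap 𝐏⟦φ⟧) r.1 commT commT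
      hDa (c ⊥ r)).symm
  obtain ⟨bt, htrans⟩ := Congruence.exists_forall_sum_rho_pow_apply_eq_of_coresLe_eq_aeval
    T∞.toTopRep hle ((𝓛).isOpen_level ⊥ _) hσqUr hcovσ hinjσ φ⁻¹ 𝐏⟦φ⟧ xt xtr hCor
  -- §6 decomposition data at `𝔔` and the vanishing on inertia (E1)
  have hID : ∀ g ∈ MulAction.stabilizer (absoluteGaloisGroup ℚ) 𝔔,
      ∀ τ ∈ 𝔔.inertia (absoluteGaloisGroup ℚ), g⁻¹ * τ * g ∈ 𝔔.inertia (absoluteGaloisGroup ℚ) := by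
    intro g hg τ hτ
    have h := conj_mem_inertia_smul hτ g⁻¹
    rw [inv_inv, MulAction.mem_stabilizer_iff.mp (Subgroup.inv_mem _ hg)] at h
    exact h
  have hφfD : φ ^ f ∈ MulAction.stabilizer (absoluteGaloisGroup ℚ) 𝔔 :=
    Subgroup.pow_mem _ hφ.mem_stabilizer f
  have hσY : ∀ t : W.tateModule p, T∞.toTopRep.ρ (σ q) t = t := fun t => by
    have h := W.galoisRepTate_eq_one_of_mem_inertia p hgood hpv h𝔔 hσI
    change W.galoisRepTate p (σ q) t = t
    rw [h]; rfl
  have hσNq : σ q ^ (((primesEquiv q : Nat.Primes) : ℕ) - 1) ∈ ((𝓛).level ⊥ (r.cons q hq).1) := by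
    change σ q ^ (((primesEquiv q : Nat.Primes) : ℕ) - 1) ∈ (𝓛).level ⊥ (insert q r.1)
    refine mem_level_of_forall 𝓛 (hbot _) fun ℓ hℓ => ?_
    rcases Finset.mem_insert.mp hℓ with rfl | hℓ
    · exact pow_mem_tameLevel_of_cov_inj 𝓛 (hcov _ hqins) (hinj _ hqins)
    · exact Subgroup.pow_mem _ (hσ q hqins ℓ (hrins ℓ hℓ) (hrq ℓ hℓ)) _
  have hNqX : ∀ w : M', ((((primesEquiv q : Nat.Primes) : ℕ) - 1 : ℕ) : ℤ) • w = 0 := fun w => by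
    rw [natCast_zsmul, ← Nat.cast_smul_eq_nsmul ℤ_[p]]
    exact CyclotomicLevel.Rat.natCast_sub_one_smul_eq_zero_of_isKolyvaginPrime W hM hKol w
  have hP1 : ∀ w : M', 𝐏⟦φ⟧.eval 1 • w = 0 := fun w =>
    CyclotomicLevel.Rat.eval_one_rubinEulerFactor_galoisRepTate_smul_eq_zero W hM hKol hφP w
  have hZ : ∀ t : W.tateModule p, ∑ k ∈ range (𝐏⟦φ⟧.natDegree + 1),
      𝐏⟦φ⟧.coeff k • T∞.toTopRep.ρ (φ⁻¹ ^ k) t =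
      (((primesEquiv q : Nat.Primes) : ℕ) - 1) • (𝐙⟦u, q⟧ φ) t := fun t => by
    have h := hZf φ hφP t
    rw [aeval_eq_sum_range, LinearMap.sum_apply, Nat.cast_smul_eq_nsmul] at h
    rw [← h]
    refine sum_congr rfl fun k _ => ?_
    rw [LinearMap.smul_apply, ← map_pow]
    rfl
  have hinjf : Function.Injective fun t : W.tateModule p => T∞.toTopRep.ρ (φ ^ f) t - t :=
    Derivative.injective_galoisRepTate_pow_sub_one W p hpv hgood h𝔔 hφ (Nat.pos_of_ne_zero hf)
  have hkill : ∀ i : ℕ, xt.1 (⟨φ ^ f, hφ₁⟩⁻¹ *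
      subgroupConj ((𝓛).level ⊥ (r.cons q hq).1) (σ q ^ i) ⟨φ ^ f, hφ₁⟩) = 0 := fun i =>
    Inertia.apply_eq_zero_of_mem_inertia_of_mem_tate W p _ ((𝓛).isOpen_level ⊥ _) hpv hgood xt h𝔔
      (Congruence.inv_mul_conj_pow_mem _ _ hID hσI hφfD i) _
  have hkillr : ∀ k : ℕ, xtr.1 (⟨φ ^ f, hle hφ₁⟩⁻¹ *
      subgroupConj ((𝓛).level ⊥ r.1) (φ⁻¹ ^ k) ⟨φ ^ f, hle hφ₁⟩) = 0 := fun k => by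
    have h1 : (⟨φ ^ f, hle hφ₁⟩⁻¹ * subgroupConj ((𝓛).level ⊥ r.1) (φ⁻¹ ^ k) ⟨φ ^ f, hle hφ₁⟩ :
        ((𝓛).level ⊥ r.1)) = 1 :=
      Subtype.ext (by
        simp only [Subgroup.coe_mul, Subgroup.coe_inv, subgroupConj_apply_coe, Subgroup.coe_one,
          inv_pow, inv_inv]
        group)
    rw [h1]; exact contOneCocycles.apply_one _
  have hyN : xt.1 ⟨σ q ^ (((primesEquiv q : Nat.Primes) : ℕ) - 1), hσNq⟩ = 0 :=
    Inertia.apply_eq_zero_of_mem_inertia_of_mem_tate W p _ ((𝓛).isOpen_level ⊥ _) hpv hgood xt h𝔔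
      (Subgroup.pow_mem _ hσI _) _
  -- §7 global cocycles extending the reduced derivative cocycles ON THE NOSE (C1); `κ`, `κ′` (F4)
  have h0r : ∀ v : T'.toTopRep,
      (∀ u : ((𝓛).level ⊥ r.1), T'.toTopRep.ρ (u : absoluteGaloisGroup ℚ) v = v) → v = 0 :=
    fun v hv => h0 v fun u => hv ⟨u, hle u.2⟩
  -- (a) `Φ_r⁰` extending `red ∘ x̃_r`; `[Φ_r⁰] = κ`
  let yr : contOneCocycles (subgroupRep T'.toTopRep ((𝓛).level ⊥ r.1)) :=
    contOneCocycles.pullback (ContinuousMonoidHom.id _)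
      ((TopRep.resFunctor ((𝓛).level ⊥ r.1).subtype).map red) xtr
  have hyr : oneCocycleClass _ yr = resSubgroup T'.toTopRep ((𝓛).level ⊥ r.1) 1 κ := by
    rw [hκ, ← red_oneCocycleClass red ((𝓛).level ⊥ r.1) xtr, hxtr]
    exact apply_noncommProd_apply_eq_of_comm (𝐫⟦red, T', ((𝓛).level ⊥ r.1)⟧).hom.toLinearMap
      r.1 commT comm
      (fun ℓ _ v => apply_deriv_apply_eq_of_comm _ (fun w => red_conjMap red (σ ℓ) w) _ v) (c ⊥ r)
  have hinvr : ∀ g : absoluteGaloisGroup ℚ,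
      conjMap T'.toTopRep ((𝓛).level ⊥ r.1) g 1 (oneCocycleClass _ yr) = oneCocycleClass _ yr :=
    fun g => by rw [hyr]; exact conjMap_resSubgroup_one T'.toTopRep _ g κ
  obtain ⟨Φr₀, hΦr₀N, -⟩ := exists_extend_of_forall_conjMap_eq T'.toTopRep ((𝓛).level ⊥ r.1)
    ((𝓛).isOpen_level ⊥ _) h0r yr hinvr
  have hΦr₀ : oneCocycleClass _ Φr₀ = κ :=
    (existsUnique_resSubgroup_eq_of_forall_conjMap_eq T'.toTopRep ((𝓛).level ⊥ r.1)
      ((𝓛).isOpen_level ⊥ _) h0r (oneCocycleClass _ yr) hinvr).unique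
      (resSubgroup_oneCocycleClass_eq_of_extend T'.toTopRep ((𝓛).level ⊥ r.1) Φr₀ yr hΦr₀N)
      hyr.symm
  have hΦr₀N' : ∀ u : ((𝓛).level ⊥ r.1), Φr₀.1 u = red.hom (xtr.1 u) := fun u => hΦr₀N u
  -- (b) `Φ⁰` extending `Ψ = D_{σ_q} (red ∘ x̃)`; `[Φ⁰] = κ′`
  let y : contOneCocycles (subgroupRep T'.toTopRep ((𝓛).level ⊥ (r.cons q hq).1)) :=
    contOneCocycles.pullback (ContinuousMonoidHom.id _)
      ((TopRep.resFunctor ((𝓛).level ⊥ (r.cons q hq).1).subtype).map red) xt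
  have hy : oneCocycleClass _ y =
      (r.1.noncommProd 𝐃⟦T'.toTopRep, ((𝓛).level ⊥ (r.cons q hq).1), σ⟧ (comm'.mono hsub))
        (𝐫⟦red, T', ((𝓛).level ⊥ (r.cons q hq).1)⟧ (c ⊥ (r.cons q hq))) := by
    rw [← red_oneCocycleClass red ((𝓛).level ⊥ (r.cons q hq).1) xt, hxt]
    exact apply_noncommProd_apply_eq_of_comm
      (𝐫⟦red, T', ((𝓛).level ⊥ (r.cons q hq).1)⟧).hom.toLinearMap r.1 commT' _
      (fun ℓ _ v => apply_deriv_apply_eq_of_comm _ (fun w => red_conjMap red (σ ℓ) w) _ v)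
      (c ⊥ (r.cons q hq))
  let Ψ : contOneCocycles (subgroupRep T'.toTopRep ((𝓛).level ⊥ (r.cons q hq).1)) :=
    ∑ i ∈ range (((primesEquiv q : Nat.Primes) : ℕ) - 1), ((i : ℤ_[p])) •
      contOneCocycles.pullback (subgroupConj ((𝓛).level ⊥ (r.cons q hq).1) (σ q ^ i))
        (conjRepHom T'.toTopRep ((𝓛).level ⊥ (r.cons q hq).1) (σ q ^ i)) y
  have hΨval : ∀ u : ((𝓛).level ⊥ (r.cons q hq).1),
      Ψ.1 u = ∑ i ∈ range (((primesEquiv q : Nat.Primes) : ℕ) - 1), (i : ℤ) •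
        T'.toTopRep.ρ (σ q ^ i) (red.hom (xt.1 (subgroupConj ((𝓛).level ⊥ (r.cons q hq).1)
          (σ q ^ i) u))) := by
    intro u
    rw [Congruence.sumConj_apply]
    refine sum_congr rfl fun i _ => ?_
    rw [Nat.cast_smul_eq_nsmul, ← natCast_zsmul]
    rfl
  have hΨcls :
      oneCocycleClass _ Ψ = resSubgroup T'.toTopRep ((𝓛).level ⊥ (r.cons q hq).1) 1 κ' := by
    rw [Congruence.oneCocycleClass_sumConj, hy, hκ']
    have hD : (r.cons q hq).1.noncommProd 𝐃⟦T'.toTopRep, ((𝓛).level ⊥ (r.cons q hq).1), σ⟧ comm' =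
        𝐃⟦T'.toTopRep, ((𝓛).level ⊥ (r.cons q hq).1), σ⟧ q *
          r.1.noncommProd 𝐃⟦T'.toTopRep, ((𝓛).level ⊥ (r.cons q hq).1), σ⟧ (comm'.mono hsub) :=
      Finset.noncommProd_insert_of_notMem _ _ _ _ hqr
    rw [hD, Module.End.mul_apply, LinearMap.sum_apply]
    refine sum_congr rfl fun j _ => ?_
    rw [Module.End.mul_apply, Module.End.natCast_apply, conjMap_hom_pow_apply,
      Nat.cast_smul_eq_nsmul]
  have hinv : ∀ g : absoluteGaloisGroup ℚ, conjMap T'.toTopRep ((𝓛).level ⊥ (r.cons q hq).1) g 1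
      (oneCocycleClass _ Ψ) = oneCocycleClass _ Ψ :=
    fun g => by rw [hΨcls]; exact conjMap_resSubgroup_one T'.toTopRep _ g κ'
  obtain ⟨Φ₀, hΦ₀N, -⟩ := exists_extend_of_forall_conjMap_eq T'.toTopRep
    ((𝓛).level ⊥ (r.cons q hq).1) ((𝓛).isOpen_level ⊥ _) h0 Ψ hinv
  have hΦ₀ : oneCocycleClass _ Φ₀ = κ' :=
    (existsUnique_resSubgroup_eq_of_forall_conjMap_eq T'.toTopRep ((𝓛).level ⊥ (r.cons q hq).1)
      ((𝓛).isOpen_level ⊥ _) h0 (oneCocycleClass _ Ψ) hinv).unique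
      (resSubgroup_oneCocycleClass_eq_of_extend T'.toTopRep ((𝓛).level ⊥ (r.cons q hq).1) Φ₀ Ψ
        hΦ₀N) hΨcls.symm
  -- §8 THEOREM C in generic form (G2) for `(Φ⁰, Φ_r⁰)`
  have hmain := apply_eq_aeval_apply_of_congruence T'.toTopRep T∞.toTopRep red
    ((𝓛).level ⊥ (r.cons q hq).1) ((𝓛).level ⊥ r.1) hle (σ q) φ (φ ^ f) hφ₁ hσY hX'σ hσNq hNqX h0
    𝐏⟦φ⟧ Q hQ hP1 hPX (𝐙⟦u, q⟧ φ) hZ hinjf xt xtr bt hkill hkillr hyN htrans ⟨tc, htc⟩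
    Φr₀ hΦr₀N' Ψ hΨval Φ₀ hΦ₀N
  -- §9 both sides depend only on the classes `κ′ = [Φ] = [Φ⁰]`, `κ = [Φ_r] = [Φ_r⁰]`
  have e1 : Φ.1 (σ q) = Φ₀.1 (σ q) :=
    apply_eq_apply_of_oneCocycleClass_eq_of_fix T'.toTopRep Φ Φ₀ (hΦ.trans hΦ₀.symm) (σ q) hX'σ
  obtain ⟨v, hv⟩ := exists_apply_eq_apply_add T'.toTopRep Φr Φr₀ (hΦr.trans hΦr₀.symm) φ
  have hz := aeval_apply_sub_eq_zero ((T'.toTopRep.ρ φ⁻¹ : M' →L[ℤ_[p]] M') : Module.End ℤ_[p] M')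
    ((T'.toTopRep.ρ φ : M' →L[ℤ_[p]] M') : Module.End ℤ_[p] M') (fun w => by
      simp only [ContinuousLinearMap.coe_coe]; exact ρ_inv_apply_ρ_apply T'.toTopRep φ w)
    𝐏⟦φ⟧ Q hQ hPX hP1 v
  simp only [ContinuousLinearMap.coe_coe] at hz
  rw [e1, hmain, hv, map_add, hz, add_zero]

end Summit.BirchSwinnertonDyer.Rank1Residual.GaloisImage.Derivative.Rat

end
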